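import Mathlib
import HarnessLib

/-!
# Cyclotomic dictionary at an odd prime `q` for `σ : ℂ ≃ₐ[ℚ] ℂ`: the Gauss sum `g_q`, `g_q² = q*`, `σ_d(g_q) = (d/q)·g_q`
(route `ManinLocalTwoThree`, crux C2 `ManinOddAtFour` stmt-BirchSwinnertonDyer-22967; cell bsd-f2-manin, C2/C3 LEAD p1 gen 19;
`--supports stmt-BirchSwinnertonDyer-22967`; D5→D6 bridge of E-es-185: the quadratic character of conductor `q` —
`d ↦ σ_d(√q*)/√q* = (d/q)` — i.e. the square class `q* = (−1)^{(q−1)/2} q` that MEMO-es §59.5 STEP 2 matches with the Kummer class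
of `δ(R_{q^b})`; combine with `ComplexAut.sqClass_eq_of_forall_kummer_eq` and `exists_complex_algEquiv_exp_pow`)

With `χ_q = (quadraticChar (ZMod q)).ringHomComp (Int.castRingHom ℂ)` the quadratic character of `ℤ/q` (values in `ℂ`) and `ψ_q(a) = e^{2πi a/q}` (`ZMod.stdAddChar`), `g_q := gaussSum χ_q ψ_q`:
* `gaussSum_quadratic_sq` — `g_q² = χ_q(−1)·q` (Mathlib `gaussSum_sq`);
* `algEquiv_stdAddChar` — `σ(ψ_q(a)) = ψ_q(d·a)` when `σ(e^{2πi/q}) = (e^{2πi/q})^d`;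
* `algEquiv_gaussSum_quadratic` — `σ(g_q) = χ_q(d)·g_q` for such `σ` and `d` coprime to `q`.

Elementary (Gauss); nothing about C2, Manin's conjecture or BSD is proved here.  [folklore]
-/

set_option autoImplicit false
-- lint-debt: the directory name repeats the summit name (sibling precedent `ManinLocalTwoThreeComplexAutExtension.lean`)
set_option linter.dupNamespace false

noncomputable section

open Complex

namespace Summit.BirchSwinnertonDyer.BirchSwinnertonDyer.Theorems.ManinLocalTwoThree.ComplexAut

variable {q : ℕ} [Fact q.Prime]

/-- **`g_q² = χ_q(−1)·q`** for an odd prime `q` (`q* = (−1)^{(q−1)/2} q`). [folklore] -/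
theorem gaussSum_quadratic_sq (hq : q ≠ 2) :
    gaussSum (((quadraticChar (ZMod q)).ringHomComp (Int.castRingHom ℂ))) (ZMod.stdAddChar (N := q)) ^ 2 = (((quadraticChar (ZMod q)).ringHomComp (Int.castRingHom ℂ))) (-1) * q := by
  have hchar : ringChar (ZMod q) ≠ 2 := by rw [ZMod.ringChar_zmod_n]; exact hq
  have h1 : ((quadraticChar (ZMod q)).ringHomComp (Int.castRingHom ℂ)) ≠ 1 := by
    rw [Ne, MulChar.ringHomComp_eq_one_iff Int.cast_injective]
    exact quadraticChar_ne_one hchar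
  have h2 : (((quadraticChar (ZMod q)).ringHomComp (Int.castRingHom ℂ))).IsQuadratic := (quadraticChar_isQuadratic (ZMod q)).comp _
  rw [gaussSum_sq h1 h2 (ZMod.isPrimitive_stdAddChar q), ZMod.card]

/-- The values of `χ_q` are integers, hence fixed by every `σ : ℂ ≃ₐ[ℚ] ℂ`. [folklore] -/
theorem algEquiv_quadCharC (σ : ℂ ≃ₐ[ℚ] ℂ) (a : ZMod q) : σ (((quadraticChar (ZMod q)).ringHomComp (Int.castRingHom ℂ)) a) = ((quadraticChar (ZMod q)).ringHomComp (Int.castRingHom ℂ)) a := by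
  rw [MulChar.ringHomComp_apply]
  exact map_intCast σ _

/-- **`σ(ψ_q(a)) = ψ_q(d·a)`** when `σ(e^{2πi/q}) = (e^{2πi/q})^d`. [folklore] -/
theorem algEquiv_stdAddChar (σ : ℂ ≃ₐ[ℚ] ℂ) {d : ℕ}
    (hσ : σ (exp (2 * Real.pi * I / q)) = exp (2 * Real.pi * I / q) ^ d) (a : ZMod q) :
    σ (ZMod.stdAddChar a) = ZMod.stdAddChar ((d : ZMod q) * a) := by
  have hζpow : ∀ n : ℕ, ZMod.stdAddChar ((n : ℕ) : ZMod q) = exp (2 * Real.pi * I / q) ^ n := by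
    intro n
    rw [← Int.cast_natCast, ZMod.stdAddChar_coe, ← exp_nat_mul]
    congr 1; push_cast; ring
  conv_lhs => rw [← ZMod.natCast_zmod_val a, hζpow, map_pow, hσ, ← pow_mul, ← hζpow]
  push_cast
  rw [ZMod.natCast_zmod_val]

/-- **Galois action on the quadratic Gauss sum: `σ(g_q) = χ_q(d)·g_q`** for `σ(e^{2πi/q}) = (e^{2πi/q})^d`, `d` coprime to `q`.
Hence `σ(√q*)/√q* = (d/q)`: the Kummer class of `q*` is the Legendre character. [folklore] -/
theorem algEquiv_gaussSum_quadratic (σ : ℂ ≃ₐ[ℚ] ℂ) {d : ℕ} (hd : d.Coprime q)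
    (hσ : σ (exp (2 * Real.pi * I / q)) = exp (2 * Real.pi * I / q) ^ d) :
    σ (gaussSum (((quadraticChar (ZMod q)).ringHomComp (Int.castRingHom ℂ))) (ZMod.stdAddChar (N := q))) =
      ((quadraticChar (ZMod q)).ringHomComp (Int.castRingHom ℂ)) (d : ZMod q) * gaussSum (((quadraticChar (ZMod q)).ringHomComp (Int.castRingHom ℂ))) (ZMod.stdAddChar (N := q)) := by
  -- `σ(g) = gaussSum χ (ψ.mulShift d)`
  have hsum : σ (gaussSum (((quadraticChar (ZMod q)).ringHomComp (Int.castRingHom ℂ))) (ZMod.stdAddChar (N := q))) =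
      gaussSum (((quadraticChar (ZMod q)).ringHomComp (Int.castRingHom ℂ))) ((ZMod.stdAddChar (N := q)).mulShift (d : ZMod q)) := by
    rw [gaussSum, gaussSum, map_sum]
    refine Finset.sum_congr rfl fun a _ => ?_
    rw [map_mul, algEquiv_quadCharC, AddChar.mulShift_apply, algEquiv_stdAddChar σ hσ]
  -- `d` is a unit mod `q`
  set u : (ZMod q)ˣ := ZMod.unitOfCoprime d hd with hu
  have hu' : ((u : ZMod q)) = (d : ZMod q) := ZMod.coe_unitOfCoprime d hd
  rw [hsum, ← hu', gaussSum_mulShift_eq, MulChar.inv_apply_eq_inv']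
  -- `χ⁻¹(u) = χ(u)` for a quadratic character with values `±1`
  congr 1
  have h2 : (((quadraticChar (ZMod q)).ringHomComp (Int.castRingHom ℂ))).IsQuadratic := (quadraticChar_isQuadratic (ZMod q)).comp _
  rcases h2 (u : ZMod q) with h | h | h
  · exfalso
    have h' : quadraticChar (ZMod q) (u : ZMod q) = 0 := by
      rw [MulChar.ringHomComp_apply, eq_intCast, Int.cast_eq_zero] at h
      exact h
    exact u.ne_zero ((quadraticChar_eq_zero_iff).mp h')
  · rw [h, inv_one]
  · rw [h, inv_neg, inv_one]

end Summit.BirchSwinnertonDyer.BirchSwinnertonDyer.Theorems.ManinLocalTwoThree.ComplexAut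

end
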